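import Summits.BirchSwinnertonDyer.BirchSwinnertonDyer.Theorems.GenusKolyvaginAtTwoPowDvdShaCardAtTwoRTKolyvaginClassOrder
import HarnessLib

/-!
# Route `GenusKolyvaginAtTwo`, crux L_T `PowDvdShaCardAtTwoRT` (stmt-BirchSwinnertonDyer-23242), LINE 18/19 stub 3a⁗, step (b),
# input I1′: the ORDER FORMULA `ord c_M(n) = 2^{M−k}` for `2^k ∥ P(n)` (McCallum, proof of Prop. 5.2, first line)

Seat `bsd-line-gk2-p2` g16 (PROVER seat 2/3, cell `bsd-f1-sign2`), `--supports 23242 --as helper`; sequel of the LEAD's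
`…RTKolyvaginClassOrder` (gk2-p1 g14: the case `k = 0`, `P(n) ∉ 2E(K[n]) ⟹ ord c_M(n) = 2^M`). THEOREMS ONLY. BSD is not proved by
any of this; neither is the crux.

McCallum 1991, proof of Prop. 5.2 (held text `book:editornd-l-functions-arithmetic` p0286), verbatim: «For `n ∈ S_r(M)`, the class
`c_M(n)` has order `p^{M−M_r}` if and only if `p^{M_r} ∥ P_n`.» With McCallum's `ord_p(P_n) = max{M : p^M ∣ P_n}` (p0284) this is
the dictionary POINT-DIVISIBILITY ↔ CLASS-ORDER at every depth of the ladder: the ladder class `c_{M_{r−1}}(n)` has order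
`2^{M_{r−1}−M_r}` BECAUSE `2^{M_r} ∥ P_n` — the hypothesis `addOrderOf (cls S) = p^(e S)` of `exists_avoiding_of_weakSwapOracle_pow`
(`…RTPrimeSwappingWeak`), and the finiteness/minimality bookkeeping of the `M_r` (Lemma 5.1). Mechanism = McCallum Cor. 4.5 applied to
the points `2^j P(n)` (`c` is `ℤ`-linear in the point, `kolyvaginClass_zsmul`) plus `E(K[n])[2^∞] = 0` (Gross Lemma 4.3 at 2,
`GenusKoly.heegner_two_pow_torsion_free`).

* `pow_zsmul_kolyvaginClass_two_eq_zero_iff` — on the crux's frame, for `j ≤ M`: **`2^j · c_M(n) = 0 ⟺ P(n) ∈ 2^{M−j} E(K[n])`**;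
* `addOrderOf_kolyvaginClass_two_eq_pow_sub` — **`2^k ∣ P(n)`, `2^{k+1} ∤ P(n)`, `k ≤ M` ⟹ `addOrderOf c_M(n) = 2^{M−k}`**;
* `kolyvaginClass_two_eq_zero_of_pow_dvd` — `2^M ∣ P(n) ⟹ c_M(n) = 0` (the case `k ≥ M`).

References: [McCallumLMS1991] §4 Cor. 4.5, §5 proof of Prop. 5.2 (first paragraph), Lemma 5.1; [GrossLMS1991] Prop. 4.7 (1),
Lemma 4.3.
-/

set_option autoImplicit false
-- the Theorems namespace of this sub repeats the summit name by design (D-0017 nested layout)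
set_option linter.dupNamespace false

noncomputable section

open scoped Classical

namespace Summit.BirchSwinnertonDyer.BirchSwinnertonDyer.Theorems.GenusExact.PlusDescent

open NumberField WeierstrassCurve Field Literature.NumberTheory.EllipticCurves
  Literature.NumberTheory.EllipticCurves.ModularForms Literature.NumberTheory.EllipticCurves.KolyvaginCocycle
  Summit.BirchSwinnertonDyer.Rank1Residual.X11b

variable {W : WeierstrassCurve ℚ} [NeZero (W.conductorNorm ℤ)] {K : Type} [Field K] [NumberField K]
  {Dt : ModularParametrizationData W (W.conductorNorm ℤ)} {β : ℤ} {ι : K →+* ℂ}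

/-- **McCallum's Cor. 4.5 for the multiples `2^j c_M(n)`** on the crux's frame (`W` globally minimal, `ρ̄_{E,2}` onto, `K` imaginary
quadratic with odd `d_K ≠ −3` and the Heegner hypothesis; `n` a square-free product of Kolyvagin primes at `2` of index `≥ M`): for
`j ≤ M`, **`2^j · c_M(n) = 0 ⟺ P(n) ∈ 2^{M−j} E(K[n])`**. (`2^j c_M(n) = c_M(2^j P(n))` vanishes iff `2^j P(n) ∈ 2^M E(K[n])`
iff — `E(K[n])[2^j] = 0` — `P(n) ∈ 2^{M−j} E(K[n])`.) [cite: McCallumLMS1991, §4 Cor. 4.5; §5 Prop. 5.2 (proof, first line)]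
[cite: GrossLMS1991, Prop. 4.7 (1) and Lemma 4.3] -/
theorem pow_zsmul_kolyvaginClass_two_eq_zero_iff [W.IsElliptic] [W.IsGloballyMinimal] (hK : IsImaginaryQuadratic K)
    (hodd : Odd (NumberField.discr K)) (h3 : NumberField.discr K ≠ -3)
    (hH : SatisfiesHeegnerHypothesis (W.conductorNorm ℤ) K) (hsurj : W.HasSurjectiveModNGaloisRep ((2 : ℤ) ^ 1))
    {n M : ℕ} (hn : Squarefree n)
    (hkol : ∀ q ∈ n.primeFactors,
      Zhang2014.IsKolyvaginPrime (W.conductorNorm ℤ) W K 2 q ∧ M ≤ Zhang2014.kolyvaginIndex W 2 q)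
    (d : (m : ℕ) → m ∣ n → KolyvaginHeegnerData Dt β ι m) {j : ℕ} (hj : j ≤ M) :
    (((2 ^ j : ℕ) : ℤ)) • (d n dvd_rfl).kolyvaginClass Nat.prime_two M = 0 ↔
      ∃ B : (W.baseChange (ringClassField K ι n)).toAffine.Point,
        (((2 ^ (M - j) : ℕ) : ℤ)) • B = (d n dvd_rfl).derivedPoint := by
  have hA := GenusKoly.isAdmissible_pointsSubgroup_two hK hodd hH hsurj hn.ne_zero (d n dvd_rfl) M
  have hP := Three.KolyCert.toGeomPoints_derivedPoint_mem_invPoints_of_dvd_zhang hK ι Dt Nat.prime_two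
    (GenusKoly.heegner_isCoprime_conductorNorm_discr hK hH) (GenusKoly.discr_lt_neg_four_of_odd hK hodd h3) hn hkol d n
    dvd_rfl
  set dn := d n dvd_rfl with hdn
  rw [dn.kolyvaginClass_of_admissible Nat.prime_two M hA hP, ← kolyvaginClass_zsmul]
  -- the point `2^j • P(n)`, as the image of a `K[n]`-point
  have hpt : (((2 ^ j : ℕ) : ℤ)) • dn.toGeomPoints dn.derivedPoint =
      dn.toGeomPoints ((((2 ^ j : ℕ) : ℤ)) • dn.derivedPoint) := (map_zsmul _ _ _).symm
  rw [KolyvaginDescent.kolyvaginClass_congr_point hA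
      (hP' := by rw [← hpt]; exact AddSubgroup.zsmul_mem _ hP _) hpt,
    kolyvaginClass_eq_zero_iff hA _
      (N := {g : absoluteGaloisGroup K | ∀ x : ringClassField K ι n,
        (show AlgebraicClosure K ≃ₐ[K] AlgebraicClosure K from g) (dn.emb x) = dn.emb x})
      (fun g hg ↦ Three.KolyCert.smul_toGeomPoints_of_forall_emb dn g hg _)
      (fun v hv ↦ Three.KolyCert.mem_pointsSubgroup_of_forall_smul_eq dn v fun g hg ↦ hv g hg)]
  obtain ⟨e, he⟩ := Nat.exists_eq_add_of_le hj
  have hMj : M - j = e := by omega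
  constructor
  · rintro ⟨_, ⟨B, rfl⟩, hB⟩
    -- `2^M • B = 2^j • P(n)` in `E(K[n])`
    have hB' : (((2 ^ M : ℕ) : ℤ)) • B = (((2 ^ j : ℕ) : ℤ)) • dn.derivedPoint := by
      apply Affine.Point.map_injective (W' := W) dn.emb.toRatAlgHom
      change dn.toGeomPoints ((((2 ^ M : ℕ) : ℤ)) • B) = dn.toGeomPoints ((((2 ^ j : ℕ) : ℤ)) • dn.derivedPoint)
      rw [map_zsmul]
      exact hB
    -- `2^j • (2^e • B − P(n)) = 0`, hence `P(n) = 2^e • B`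
    have hzero : (((2 ^ j : ℕ) : ℤ)) • ((((2 ^ e : ℕ) : ℤ)) • B - dn.derivedPoint) = 0 := by
      rw [zsmul_sub, smul_smul, ← hB', he]
      push_cast
      ring_nf
      simp
    have hfree := GenusKoly.heegner_two_pow_torsion_free (ι := ι) hK hodd hH hsurj hn.ne_zero j _ hzero
    rw [sub_eq_zero] at hfree
    exact ⟨B, by rw [hMj]; exact hfree⟩
  · rintro ⟨B, hB⟩
    refine ⟨dn.toGeomPoints B, ⟨B, rfl⟩, ?_⟩
    rw [← map_zsmul]
    congr 1
    rw [← hB, smul_smul, hMj, he]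
    push_cast
    ring_nf

/-- **`2^M ∣ P(n) ⟹ c_M(n) = 0`** (McCallum Cor. 4.5, «if» direction, on the crux's frame). [cite: McCallumLMS1991, §4 Cor. 4.5] -/
theorem kolyvaginClass_two_eq_zero_of_pow_dvd [W.IsElliptic] [W.IsGloballyMinimal] (hK : IsImaginaryQuadratic K)
    (hodd : Odd (NumberField.discr K)) (h3 : NumberField.discr K ≠ -3)
    (hH : SatisfiesHeegnerHypothesis (W.conductorNorm ℤ) K) (hsurj : W.HasSurjectiveModNGaloisRep ((2 : ℤ) ^ 1))
    {n M : ℕ} (hn : Squarefree n)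
    (hkol : ∀ q ∈ n.primeFactors,
      Zhang2014.IsKolyvaginPrime (W.conductorNorm ℤ) W K 2 q ∧ M ≤ Zhang2014.kolyvaginIndex W 2 q)
    (d : (m : ℕ) → m ∣ n → KolyvaginHeegnerData Dt β ι m)
    (hdiv : ∃ B : (W.baseChange (ringClassField K ι n)).toAffine.Point, (((2 ^ M : ℕ) : ℤ)) • B = (d n dvd_rfl).derivedPoint) :
    (d n dvd_rfl).kolyvaginClass Nat.prime_two M = 0 := by
  have h := (pow_zsmul_kolyvaginClass_two_eq_zero_iff hK hodd h3 hH hsurj hn hkol d (Nat.zero_le M)).mpr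
    (by rw [Nat.sub_zero]; exact hdiv)
  rwa [pow_zero, Nat.cast_one, one_smul] at h

/-- **THE ORDER FORMULA** (McCallum, proof of Prop. 5.2: «the class `c_M(n)` has order `p^{M−M_r}` if and only if `p^{M_r} ∥ P_n`»),
at `p = 2` on the crux's frame: if `2^k ∣ P(n)` and `2^{k+1} ∤ P(n)` in `E(K[n])` with `k ≤ M`, then
**`addOrderOf c_M(n) = 2^{M−k}`**. The case `k = 0` is the LEAD's `addOrderOf_kolyvaginClass_two_eq_pow_of_not_two_dvd`; this is
the dictionary «`2^{M_r} ∥ P_n` ⟹ `ord c_{M_{r−1}}(n) = 2^{M_{r−1}−M_r}`» of every rung of the ladder (hypothesis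
`addOrderOf (cls S) = p^(e S)` of `exists_avoiding_of_weakSwapOracle_pow`). [cite: McCallumLMS1991, §5 Prop. 5.2 (proof, first
paragraph); §4 Cor. 4.5] -/
theorem addOrderOf_kolyvaginClass_two_eq_pow_sub [W.IsElliptic] [W.IsGloballyMinimal] (hK : IsImaginaryQuadratic K)
    (hodd : Odd (NumberField.discr K)) (h3 : NumberField.discr K ≠ -3)
    (hH : SatisfiesHeegnerHypothesis (W.conductorNorm ℤ) K) (hsurj : W.HasSurjectiveModNGaloisRep ((2 : ℤ) ^ 1))
    {n M : ℕ} (hn : Squarefree n)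
    (hkol : ∀ q ∈ n.primeFactors,
      Zhang2014.IsKolyvaginPrime (W.conductorNorm ℤ) W K 2 q ∧ M ≤ Zhang2014.kolyvaginIndex W 2 q)
    (d : (m : ℕ) → m ∣ n → KolyvaginHeegnerData Dt β ι m) {k : ℕ} (hkM : k ≤ M)
    (hk : ∃ B : (W.baseChange (ringClassField K ι n)).toAffine.Point, (((2 ^ k : ℕ) : ℤ)) • B = (d n dvd_rfl).derivedPoint)
    (hk1 : ¬ ∃ B : (W.baseChange (ringClassField K ι n)).toAffine.Point,
      (((2 ^ (k + 1) : ℕ) : ℤ)) • B = (d n dvd_rfl).derivedPoint) :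
    addOrderOf ((d n dvd_rfl).kolyvaginClass Nat.prime_two M) = 2 ^ (M - k) := by
  -- `2^(M-k) • c = 0`
  have hkill : (((2 ^ (M - k) : ℕ) : ℤ)) • (d n dvd_rfl).kolyvaginClass Nat.prime_two M = 0 :=
    (pow_zsmul_kolyvaginClass_two_eq_zero_iff hK hodd h3 hH hsurj hn hkol d (Nat.sub_le M k)).mpr
      (by rw [Nat.sub_sub_self hkM]; exact hk)
  rcases Nat.eq_zero_or_pos (M - k) with h0 | hpos
  · -- `k = M`: the class vanishes
    rw [h0, pow_zero, AddMonoid.addOrderOf_eq_one_iff]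
    rw [h0, pow_zero, Nat.cast_one, one_smul] at hkill
    exact hkill
  · obtain ⟨e, he⟩ := Nat.exists_eq_add_of_lt hpos
    rw [zero_add] at he
    rw [he]
    refine addOrderOf_eq_prime_pow (p := 2) (n := e) ?_ ?_
    · -- `2^e • c ≠ 0`: else `P(n) ∈ 2^{M−e} = 2^{k+1} E(K[n])`
      rw [← natCast_zsmul]
      intro h0
      have h' := (pow_zsmul_kolyvaginClass_two_eq_zero_iff hK hodd h3 hH hsurj hn hkol d (j := e) (by omega)).mp
        (by exact_mod_cast h0)
      have hMe : M - e = k + 1 := by omega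
      rw [hMe] at h'
      exact hk1 h'
    · rw [← natCast_zsmul, ← he]
      exact_mod_cast hkill

end Summit.BirchSwinnertonDyer.BirchSwinnertonDyer.Theorems.GenusExact.PlusDescent

end
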